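import Summits.BirchSwinnertonDyer.BirchSwinnertonDyer.Theorems.ManinLocalTwoThreeEtaMonomialsFiftySix
import Summits.BirchSwinnertonDyer.BirchSwinnertonDyer.Theorems.ManinLocalTwoThreeEtaBasisFortyFiveA
import HarnessLib

/-!
# Level 45: the coordinates `T = η₁η₅/(η₉η₄₅) = E₁E₅/(q²E₉E₄₅)`, `S = η₃²η₁₅²/(η₉²η₄₅²) = E₃²E₁₅²/(q³E₉²E₄₅²)` as `q`-monomials times Euler
# functions, the derivative of `T`, `E₁′`, `E₅′` modulo `o(q⁹)`, and the `q`-limit (I1)₄₅ `(2S − 3T)² − (4(T+2)³ − 3(T+2)² − 20) → 0` at `i∞`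

Cell bsd-f2-manin, route `ManinLocalTwoThree` (crux C3 `ManinPrimeToThreeAtNine`, stmt-22968: `3² ∣ 45`), prover seat p2 gen 28.  On `45a1 = [1,−1,0,0,−5]`
(`y² + xy = x³ − x² − 5`): `x = T + 2`, `2y + x = 2S − 3T`, so the curve reads `(2S − 3T)² = 4x³ + b₂x² + 2b₄x + b₆ = 4(T+2)³ − 3(T+2)² − 20` (I1)₄₅ and
`x′ = −2πiφ₄₅·(2y + x)` reads `T′ = −2πiφ₄₅(2S − 3T)` (I2a)₄₅.  This file: the field forms `T45_eq`, `S45_eq`, the logarithmic derivative `deriv_T45`,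
the truncations `(2πi)⁻¹E₁′`, `(2πi)⁻¹E₅′ mod o(q⁹)` (for (I2a)), and **(I1)₄₅ as a `q`-limit**: the numerator
`G = (2N_S − 3qN_TD_T)² − 4(N_T + 2q²D_T)³D_T + 3q²(N_T + 2q²D_T)²D_T² + 20q⁶D_T⁴` (`N_T = E₁E₅`, `D_T = E₉E₄₅`, `N_S = E₃²E₁₅²`, `D_S = D_T²`)
is `o(q⁶)` by the `QRemainder` calculus, hence `F = G/(q⁶D_T⁴) → 0`.  Seat-folder certificate `scripts/level45.py` (exact to `O(q⁶³)`).
No definition, no named fact, no sorry; nothing here proves C3, Manin's conjecture or BSD. [cite: Ligozat1975, Ch. 4] [cite: CremonaAlgorithms1997, Table 1 (45a1)]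
-/

set_option autoImplicit false
-- lint-debt: the directory name repeats the summit name (sibling precedent `ManinLocalTwoThreeEtaMonomialsFiftySix.lean`)
set_option linter.dupNamespace false

noncomputable section

open Complex Filter Topology Set Asymptotics Polynomial
open UpperHalfPlane hiding I
open scoped Real Topology Manifold MatrixGroups
open Literature.NumberTheory.EllipticCurves Literature.NumberTheory.EllipticCurves.ModularForms

namespace Summit.BirchSwinnertonDyer.BirchSwinnertonDyer.Theorems.ManinLocalTwoThree.EtaMonomialsFortyFive

open QRemainder EulerRemainders EulerRemaindersTwenty LevelFortyFour LevelFortyFive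
open LigozatIdentities (hasDerivAt_eulerFn_comp)

/-! ## §1 `T`, `S` as `q`-monomials times Euler functions; the derivative of `T` -/

/-- **`T = η₁η₅/(η₉η₄₅) = E₁E₅/(q²E₉E₄₅)`.** [folklore] -/
theorem T45_eq (τ : ℍ) :
    etaQuotient 45 (expFn [(1, 1), (5, 1), (9, -1), (45, -1)]) τ = (eulerFn 1 τ * eulerFn 5 τ) / (Function.Periodic.qParam 1 (τ : ℂ) ^ 2 * (eulerFn 9 τ * eulerFn 45 τ)) := by
  have hE9 := eulerFn_ne_zero (by norm_num : 0 < 9) τ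
  have hE45 := eulerFn_ne_zero (by norm_num : 0 < 45) τ
  have hq := qParam_ne_zero τ
  rw [etaQuotient_eq_cexp_mul_prod, show Nat.divisors 45 = {1, 3, 5, 9, 15, 45} by decide]
  have hsum : (∑ δ ∈ ({1, 3, 5, 9, 15, 45} : Finset ℕ), (δ : ℤ) * expFn [(1, 1), (5, 1), (9, -1), (45, -1)] δ) = (-(24 * 2 : ℕ) : ℤ) := by decide
  rw [hsum, cexp_neg_eq_inv_qParam_pow]
  rw [Finset.prod_insert (by decide), Finset.prod_insert (by decide), Finset.prod_insert (by decide), Finset.prod_insert (by decide),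
    Finset.prod_insert (by decide), Finset.prod_singleton]
  rw [show expFn [(1, 1), (5, 1), (9, -1), (45, -1)] 1 = 1 by decide,
    show expFn [(1, 1), (5, 1), (9, -1), (45, -1)] 3 = 0 by decide,
    show expFn [(1, 1), (5, 1), (9, -1), (45, -1)] 5 = 1 by decide,
    show expFn [(1, 1), (5, 1), (9, -1), (45, -1)] 9 = (-1) by decide,
    show expFn [(1, 1), (5, 1), (9, -1), (45, -1)] 15 = 0 by decide,
    show expFn [(1, 1), (5, 1), (9, -1), (45, -1)] 45 = (-1) by decide]
  simp only [zpow_neg, zpow_ofNat, pow_one]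
  field_simp

/-- **`S = η₃²η₁₅²/(η₉²η₄₅²) = E₃²E₁₅²/(q³E₉²E₄₅²)`.** [folklore] -/
theorem S45_eq (τ : ℍ) :
    etaQuotient 45 (expFn [(3, 2), (9, -2), (15, 2), (45, -2)]) τ = (eulerFn 3 τ ^ 2 * eulerFn 15 τ ^ 2) / (Function.Periodic.qParam 1 (τ : ℂ) ^ 3 * (eulerFn 9 τ ^ 2 * eulerFn 45 τ ^ 2)) := by
  have hE9 := eulerFn_ne_zero (by norm_num : 0 < 9) τ
  have hE45 := eulerFn_ne_zero (by norm_num : 0 < 45) τ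
  have hq := qParam_ne_zero τ
  rw [etaQuotient_eq_cexp_mul_prod, show Nat.divisors 45 = {1, 3, 5, 9, 15, 45} by decide]
  have hsum : (∑ δ ∈ ({1, 3, 5, 9, 15, 45} : Finset ℕ), (δ : ℤ) * expFn [(3, 2), (9, -2), (15, 2), (45, -2)] δ) = (-(24 * 3 : ℕ) : ℤ) := by decide
  rw [hsum, cexp_neg_eq_inv_qParam_pow]
  rw [Finset.prod_insert (by decide), Finset.prod_insert (by decide), Finset.prod_insert (by decide), Finset.prod_insert (by decide),
    Finset.prod_insert (by decide), Finset.prod_singleton]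
  rw [show expFn [(3, 2), (9, -2), (15, 2), (45, -2)] 1 = 0 by decide,
    show expFn [(3, 2), (9, -2), (15, 2), (45, -2)] 3 = 2 by decide,
    show expFn [(3, 2), (9, -2), (15, 2), (45, -2)] 5 = 0 by decide,
    show expFn [(3, 2), (9, -2), (15, 2), (45, -2)] 9 = (-2) by decide,
    show expFn [(3, 2), (9, -2), (15, 2), (45, -2)] 15 = 2 by decide,
    show expFn [(3, 2), (9, -2), (15, 2), (45, -2)] 45 = (-2) by decide]
  simp only [zpow_neg, zpow_ofNat]
  field_simp

/-- **`T′ = T · (E₁′/E₁ + E₅′/E₅ − 2·2πi − E₉′/E₉ − E₄₅′/E₄₅)`.** [folklore] -/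
theorem deriv_T45 (τ : ℍ) :
    deriv (etaQuotient 45 (expFn [(1, 1), (5, 1), (9, -1), (45, -1)]) ∘ ofComplex) τ
      = eulerFn 1 τ * eulerFn 5 τ / (Function.Periodic.qParam 1 (τ : ℂ) ^ 2 * (eulerFn 9 τ * eulerFn 45 τ))
        * (deriv (eulerFn 1 ∘ ofComplex) τ / eulerFn 1 τ + deriv (eulerFn 5 ∘ ofComplex) τ / eulerFn 5 τ - 2 * (2 * π * I)
          - deriv (eulerFn 9 ∘ ofComplex) τ / eulerFn 9 τ - deriv (eulerFn 45 ∘ ofComplex) τ / eulerFn 45 τ) := by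
  have hE1 := eulerFn_ne_zero (by norm_num : 0 < 1) τ
  have hE5 := eulerFn_ne_zero (by norm_num : 0 < 5) τ
  have hE9 := eulerFn_ne_zero (by norm_num : 0 < 9) τ
  have hE45 := eulerFn_ne_zero (by norm_num : 0 < 45) τ
  have hq := qParam_ne_zero τ
  have hfun : (etaQuotient 45 (expFn [(1, 1), (5, 1), (9, -1), (45, -1)]) ∘ ofComplex) =ᶠ[𝓝 (τ : ℂ)]
      fun z ↦ (eulerFn 1 ∘ ofComplex) z * (eulerFn 5 ∘ ofComplex) z
        / (Function.Periodic.qParam 1 z ^ 2 * ((eulerFn 9 ∘ ofComplex) z * (eulerFn 45 ∘ ofComplex) z)) := by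
    filter_upwards [isOpen_upperHalfPlaneSet.mem_nhds τ.im_pos] with z hz
    simp only [Function.comp_apply, T45_eq, ofComplex_apply_of_im_pos hz]
  rw [hfun.deriv_eq]
  have h1 := hasDerivAt_eulerFn_comp 1 τ
  have h5 := hasDerivAt_eulerFn_comp 5 τ
  have h9 := hasDerivAt_eulerFn_comp 9 τ
  have h45 := hasDerivAt_eulerFn_comp 45 τ
  have hqd : HasDerivAt (Function.Periodic.qParam 1) (2 * π * I * Function.Periodic.qParam 1 (τ : ℂ)) τ := by
    simpa using hasDerivAt_qParam 1 (τ : ℂ)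
  have hden : Function.Periodic.qParam 1 (τ : ℂ) ^ 2 * ((eulerFn 9 ∘ ofComplex) τ * (eulerFn 45 ∘ ofComplex) τ) ≠ 0 := by
    simp only [Function.comp_apply, ofComplex_apply]
    exact mul_ne_zero (pow_ne_zero _ hq) (mul_ne_zero hE9 hE45)
  have hD := (h1.fun_mul h5).fun_div ((hqd.fun_pow 2).fun_mul (h9.fun_mul h45)) hden
  rw [hD.deriv]
  simp only [Function.comp_apply, ofComplex_apply]
  field_simp
  ring

/-! ## §2 `E₁′`, `E₅′` modulo `o(q⁹)` -/

/-- **`E₁′ = 2πi(-q - 2 * q ^ 2 + 5 * q ^ 5 + 7 * q ^ 7) + o(q⁹)`.** [folklore] -/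
theorem tendsto_deriv_eulerFn_one_nine :
    Tendsto (fun τ : ℍ ↦ (deriv (eulerFn 1 ∘ ofComplex) τ
      - (C (2 * π * I) * (-X - 2 * X ^ 2 + 5 * X ^ 5 + 7 * X ^ 7) : ℂ[X]).eval (Function.Periodic.qParam 1 (τ : ℂ)))
      / Function.Periodic.qParam 1 (τ : ℂ) ^ 9) atImInfty (𝓝 0) := by
  refine congr_poly ?_ (congr_fun (fun τ ↦ deriv_eulerFn_sub_one 1 τ)
    (tendsto_deriv_of_isCuspFunction (isCuspFunction_eulerFn_sub_one (by norm_num : 0 < 1)) 9))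
  have h : ∀ n : ℕ, n ≤ 9 → (PowerSeries.coeff n (formalEulerScaled 1) : ℤ) = ([1, -1, -1, 0, 0, 1, 0, 1, 0, 0] : List ℤ).getD n 0 := by
    intro n hn
    rw [coeff_formalEulerScaled_eq_of_le (by omega)]
    interval_cases n <;> decide
  have hc : ∀ n : ℕ, n ≠ 0 → n ≤ 9 → (qExpansion 1 (eulerFn 1 - 1)).coeff n = ((([1, -1, -1, 0, 0, 1, 0, 1, 0, 0] : List ℤ).getD n 0 : ℤ) : ℂ) :=
    fun n hn hnM ↦ by rw [qExpansion_eulerFn_sub_one_coeff_of_ne_zero (by norm_num) hn, h n hnM]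
  simp only [Finset.sum_range_succ, Finset.sum_range_zero, hc 1 (by norm_num) (by norm_num),
    hc 2 (by norm_num) (by norm_num),
    hc 3 (by norm_num) (by norm_num),
    hc 4 (by norm_num) (by norm_num),
    hc 5 (by norm_num) (by norm_num),
    hc 6 (by norm_num) (by norm_num),
    hc 7 (by norm_num) (by norm_num),
    hc 8 (by norm_num) (by norm_num),
    hc 9 (by norm_num) (by norm_num)]
  norm_num
  simp only [map_ofNat]
  ring

/-- **`E₅′ = 2πi(-5 * q ^ 5) + o(q⁹)`.** [folklore] -/
theorem tendsto_deriv_eulerFn_five_nine :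
    Tendsto (fun τ : ℍ ↦ (deriv (eulerFn 5 ∘ ofComplex) τ
      - (C (2 * π * I) * (-5 * X ^ 5) : ℂ[X]).eval (Function.Periodic.qParam 1 (τ : ℂ)))
      / Function.Periodic.qParam 1 (τ : ℂ) ^ 9) atImInfty (𝓝 0) := by
  refine congr_poly ?_ (congr_fun (fun τ ↦ deriv_eulerFn_sub_one 5 τ)
    (tendsto_deriv_of_isCuspFunction (isCuspFunction_eulerFn_sub_one (by norm_num : 0 < 5)) 9))
  have h : ∀ n : ℕ, n ≤ 9 → (PowerSeries.coeff n (formalEulerScaled 5) : ℤ) = ([1, 0, 0, 0, 0, -1, 0, 0, 0, 0] : List ℤ).getD n 0 := by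
    intro n hn
    rw [coeff_formalEulerScaled_eq_of_le (by omega)]
    interval_cases n <;> decide
  have hc : ∀ n : ℕ, n ≠ 0 → n ≤ 9 → (qExpansion 1 (eulerFn 5 - 1)).coeff n = ((([1, 0, 0, 0, 0, -1, 0, 0, 0, 0] : List ℤ).getD n 0 : ℤ) : ℂ) :=
    fun n hn hnM ↦ by rw [qExpansion_eulerFn_sub_one_coeff_of_ne_zero (by norm_num) hn, h n hnM]
  simp only [Finset.sum_range_succ, Finset.sum_range_zero, hc 1 (by norm_num) (by norm_num),
    hc 2 (by norm_num) (by norm_num),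
    hc 3 (by norm_num) (by norm_num),
    hc 4 (by norm_num) (by norm_num),
    hc 5 (by norm_num) (by norm_num),
    hc 6 (by norm_num) (by norm_num),
    hc 7 (by norm_num) (by norm_num),
    hc 8 (by norm_num) (by norm_num),
    hc 9 (by norm_num) (by norm_num)]
  norm_num
  simp only [map_ofNat]
  ring

/-! ## §3 (I1)₄₅ as a `q`-limit -/

set_option maxHeartbeats 800000 in -- ~25 staged `QRemainder` steps at precision 6 in one declaration
/-- **(I1)₄₅ as a limit**: `(2S − 3T)² − (4(T+2)³ − 3(T+2)² − 20) → 0` at `i∞`. [cite: Ligozat1975, Ch. 4] -/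
theorem tendsto_I1 :
    Tendsto (fun τ : ℍ ↦ (2 * etaQuotient 45 (expFn [(3, 2), (9, -2), (15, 2), (45, -2)]) τ - 3 * etaQuotient 45 (expFn [(1, 1), (5, 1), (9, -1), (45, -1)]) τ) ^ 2
      - (4 * (etaQuotient 45 (expFn [(1, 1), (5, 1), (9, -1), (45, -1)]) τ + 2) ^ 3 - 3 * (etaQuotient 45 (expFn [(1, 1), (5, 1), (9, -1), (45, -1)]) τ + 2) ^ 2 - 20)) atImInfty (𝓝 0) := by

  have h1 := EulerRemaindersTwenty.tendsto_mono (show 6 ≤ 33 by norm_num) LevelFortyFour.tendsto_eulerFn_one_thirtyThree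
  have h2 := EulerRemaindersTwenty.tendsto_mono (show 6 ≤ 33 by norm_num) LevelFortyFive.tendsto_eulerFn_five_thirtyThree
  have h3 := QRemainder.reduce (1 - X - X ^ 2 + X ^ 6) (2 - 2 * X ^ 3 + X ^ 4 - X ^ 5 - 2 * X ^ 8 + X ^ 13 + 2 * X ^ 15 + 2 * X ^ 18 - 2 * X ^ 20 + X ^ 23 - X ^ 24 - X ^ 29 - X ^ 30 - X ^ 33 + X ^ 40 + X ^ 44 : ℂ[X]) (by ring) (QRemainder.mul h1 h2)
  have h4 := tendsto_eulerFn (δ := 9) (m := 6) (by norm_num)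
  have h5 := tendsto_eulerFn (δ := 45) (m := 6) (by norm_num)
  have h6 := QRemainder.mul h4 h5
  have h7 := EulerRemaindersTwenty.tendsto_mono (show 6 ≤ 33 by norm_num) LevelFortyFive.tendsto_eulerFn_three_thirtyThree
  have h8 := QRemainder.reduce (1 - 2 * X ^ 3 - X ^ 6) (2 * X ^ 2 + X ^ 5 + 2 * X ^ 8 - 2 * X ^ 11 - 2 * X ^ 17 - 2 * X ^ 20 + X ^ 23 + 2 * X ^ 29 + X ^ 35 : ℂ[X]) (by ring) (QRemainder.pow h7 2)
  have h9 := tendsto_eulerFn (δ := 15) (m := 6) (by norm_num)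
  have h10 := QRemainder.pow h9 2
  have h11 := QRemainder.mul h8 h10
  have h12 := QRemainder.reduce (2 - 4 * X ^ 3 - 2 * X ^ 6) (0 : ℂ[X]) (by simp only [map_ofNat]; ring) (QRemainder.const_mul (2 : ℂ) h11)
  have h13 := QRemainder.mul h3 h6
  have h14 := QRemainder.reduce (X - X ^ 2 - X ^ 3) (1 : ℂ[X]) (by ring) (QRemainder.qParam_pow_mul 1 h13)
  have h15 := QRemainder.reduce (3 * X - 3 * X ^ 2 - 3 * X ^ 3) (0 : ℂ[X]) (by simp only [map_ofNat]; ring) (QRemainder.const_mul (3 : ℂ) h14)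
  have h16 := QRemainder.sub h12 h15
  have h17 := QRemainder.qParam_pow_mul 2 h6
  have h18 := QRemainder.reduce (2 * X ^ 2) (0 : ℂ[X]) (by simp only [map_ofNat]; ring) (QRemainder.const_mul (2 : ℂ) h17)
  have h19 := QRemainder.add h3 h18
  have h20 := QRemainder.reduce (4 - 12 * X + 21 * X ^ 2 - 22 * X ^ 3 + 15 * X ^ 4 - 6 * X ^ 5 - 7 * X ^ 6) (12 - 12 * X + 4 * X ^ 2 + 4 * X ^ 5 : ℂ[X]) (by ring) (QRemainder.pow h16 2)
  have h21 := QRemainder.reduce (1 - 3 * X + 6 * X ^ 2 - 7 * X ^ 3 + 6 * X ^ 4 - 3 * X ^ 5 + 4 * X ^ 6) (-6 + 9 * X - 6 * X ^ 2 + 3 * X ^ 3 + 3 * X ^ 5 - 3 * X ^ 6 + 3 * X ^ 7 + X ^ 11 : ℂ[X]) (by ring) (QRemainder.pow h19 3)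
  have h22 := QRemainder.mul h21 h6
  have h23 := QRemainder.reduce (4 - 12 * X + 24 * X ^ 2 - 28 * X ^ 3 + 24 * X ^ 4 - 12 * X ^ 5 + 16 * X ^ 6) (0 : ℂ[X]) (by simp only [map_ofNat]; ring) (QRemainder.const_mul (4 : ℂ) h22)
  have h24 := QRemainder.reduce (1 - 2 * X + 3 * X ^ 2 - 2 * X ^ 3 + X ^ 4 + 2 * X ^ 6) (-2 + 2 * X + X ^ 5 : ℂ[X]) (by ring) (QRemainder.pow h19 2)
  have h25 := QRemainder.pow h6 2
  have h26 := QRemainder.mul h24 h25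
  have h27 := QRemainder.reduce (X ^ 2 - 2 * X ^ 3 + 3 * X ^ 4 - 2 * X ^ 5 + X ^ 6) (2 * X : ℂ[X]) (by ring) (QRemainder.qParam_pow_mul 2 h26)
  have h28 := QRemainder.reduce (3 * X ^ 2 - 6 * X ^ 3 + 9 * X ^ 4 - 6 * X ^ 5 + 3 * X ^ 6) (0 : ℂ[X]) (by simp only [map_ofNat]; ring) (QRemainder.const_mul (3 : ℂ) h27)
  have h29 := QRemainder.pow h6 4
  have h30 := QRemainder.qParam_pow_mul 6 h29
  have h31 := QRemainder.reduce (20 * X ^ 6) (0 : ℂ[X]) (by simp only [map_ofNat]; ring) (QRemainder.const_mul (20 : ℂ) h30)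
  have h32 := QRemainder.sub h20 h23
  have h33 := QRemainder.add h32 h28
  have h34 := QRemainder.add h33 h31
  have hfin := QRemainder.congr_poly (P' := (0 : ℂ[X])) (by ring) h34
  have hlim := (QRemainder.tendsto_div_pow 6 le_rfl hfin).mul
    ((((isIntUnitQExp_eulerFn (by norm_num : 0 < 9)).tendsto_one.mul
      (isIntUnitQExp_eulerFn (by norm_num : 0 < 45)).tendsto_one).pow 4).inv₀ (by norm_num))
  rw [zero_mul] at hlim
  refine hlim.congr fun τ ↦ ?_
  have hE9 := eulerFn_ne_zero (by norm_num : 0 < 9) τ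
  have hE45 := eulerFn_ne_zero (by norm_num : 0 < 45) τ
  have hq := qParam_ne_zero τ
  rw [T45_eq, S45_eq]
  field_simp
  ring

end Summit.BirchSwinnertonDyer.BirchSwinnertonDyer.Theorems.ManinLocalTwoThree.EtaMonomialsFortyFive

end
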